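import Literature.Computability.Complexity.SearchToDecisionBPP
import Literature.Computability.Complexity.ExpClosure
import HarnessLib

/-!
# Refuters for `EXP` against `BPP` (Chen–Jin–Santhanam–Williams, Thm. 1.2), II: the list-refuter

Topic `Literature/Computability/MetaComplexity`. Second proof file towards the named fact
`constructiveSeparation_of_not_subset_BPP_EXP` (`ConstructiveSeparations.lean`;
[ChenEtAl2022] L. Chen, C. Jin, R. Santhanam, R. Williams, *Constructive separations and their
consequences*, FOCS 2021, Thm. 1.2; arXiv:2203.14379v5, §5.1, Thm. 5.4 with the list-refuter lemma). It renders
the **search-to-decision list-refuter** (Algorithm 1 of the printed proof) and its analysis, with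
every machine obtained from the tree's `FP` algebra — in fact from the oracle search procedure
`searchFnD` of `SearchToDecisionBPP.lean` — so that no Turing machine is programmed here.

Printed algorithm (prefixes `x`; here suffixes `w`, grown at the front as the tree's transducers
do): starting from `w = ε`, while `|w| < n`, ask the oracle procedure `R^A(1ⁿ, 0w)` and
`R^A(1ⁿ, 1w)` ("does some `y ∈ {0,1}ⁿ` extending `bw` have `L(y) ≠ A(y)`?") and prepend the
first accepted bit, stopping when both are rejected; output the final `w` and the last queries.

* **The canonical run** (`cstep`, `crun`): the same loop against an abstract oracle
  `O : {0,1}* → Prop`, as a clocked iteration that idles once stuck or full (`crun_of_le`); its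
  invariant (`crun_inv`: every non-empty state was accepted), oracle congruence along the path
  (`crun_congr`: two oracles agreeing on the `≤ 2(n+1)` path queries give the same run — the
  event the union bound of part III controls), and **the three cases of the printed correctness
  proof** (`crun_full_of_consistent`): if `n ≥ 1` is a bad length and none of the queries
  `w, 0w, 1w` at the final state `w` is answered inconsistently with the truth
  `G(w') = ∃ v, |v ++ w'| = n ∧ Bad(v ++ w')`, then `|w| = n` and `Bad w` — "`|x| = 0` …
  impossible; `1 ≤ |x| < n` … also impossible; `|x| = n` … `L(x) ≠ A(x)`".
* **The machine** (`orc`, `stopLang`, `searchFnD_stop_orc`): with the coins `r` carried in the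
  instance `⟨u, r⟩` (`u = 1ⁿ`), the coin oracle `⟨⟨u, r⟩, w⟩ ∈ orc ↔ ⟨Q⟨u, w⟩, r⟩ ∈ L_amp`
  (`Q` the query map, `L_amp` an amplified `BPP` witness) and the stop language
  "both extensions rejected or `|u| ≤ |w|`" are in `P`, and `searchFnD stopLang orc X ⟨u, r⟩`
  IS the canonical run with oracle `w ↦ [⟨Q⟨u, w⟩, r⟩ ∈ L_amp]` (`roundFnD_boolPair`).
* **List-refuter plumbing** (`invFn`, `invFn_spec`): the refuter `B⁽ⁱ⁾` on input `1ᵐ` must recover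
  `n` with `ℓ(n) = m` for the strictly increasing query-length polynomial `ℓ`; the bounded search
  `j ↦ j + 1` until `ℓ(j) = m` is again `searchFnD` (stop language `{⟨a, b⟩ | ℓ(|b|) = |a| ∨ |a| ≤ |b|}`,
  empty extension oracle).
* **Refuters as string functions** (`strRefuter`, `strRefuter_isPolyTime`, `strRefuter_pr`): a
  Gill machine `RandAlg ℕ {0,1}*` on `1ᵐ` whose run map read through `⟨1ᵐ, r⟩` is an `FP`
  function is probabilistic polynomial time, and its probabilities are counting probabilities.

## References

* [ChenEtAl2022] L. Chen, C. Jin, R. Santhanam, R. Williams, FOCS 2021 / arXiv:2203.14379v5,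
  §5.1: the definition of constant-size list-refuters, the lemma converting them into refuters,
  Thm. 5.4 (`𝒟 ∈ {PSPACE, EXP, NEXP}`) and Algorithm 1 (the list-refuter).
* [AroraBarakCC2009] S. Arora, B. Barak, *Computational Complexity: A Modern Approach*, CUP 2009,
  Thm. 2.18 (search to decision), §7.1 (probabilistic machines), §1.3.
-/

noncomputable section

namespace Literature.Computability.MetaComplexity

open _root_.Computability Complexity Polynomial

/-! ### The canonical run of the list-refuter -/

section Canon

variable (n : ℕ) (O : List Bool → Prop)

open Classical in
/-- **One round of Algorithm 1** against the oracle `O` at input length `n`: keep `w` if both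
one-bit extensions are rejected or `w` is already full (`n ≤ |w|`), otherwise prepend the first
accepted bit. [cite: ChenEtAl2022, §5.1 (Algorithm 1)] -/
def cstep (w : List Bool) : List Bool :=
  if (¬ O (false :: w) ∧ ¬ O (true :: w)) ∨ n ≤ w.length then w
  else if O (false :: w) then false :: w else true :: w

/-- **The run of Algorithm 1** for `k` rounds from `ε`: `crun n O k = (cstep n O)^[k] ε`.
[cite: ChenEtAl2022, §5.1 (Algorithm 1)] -/
def crun (k : ℕ) : List Bool :=
  (cstep n O)^[k] []

/-- `crun n O 0 = ε`. [folklore] -/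
@[simp] theorem crun_zero : crun n O 0 = [] := rfl

/-- `crun n O (k + 1) = cstep n O (crun n O k)`. [folklore] -/
theorem crun_succ (k : ℕ) : crun n O (k + 1) = cstep n O (crun n O k) := by
  simp only [crun, Function.iterate_succ_apply']

/-- A round either idles or prepends an accepted bit to a short state. [folklore] -/
theorem cstep_eq_self_or (w : List Bool) :
    cstep n O w = w ∨ (w.length < n ∧ ∃ b : Bool, cstep n O w = b :: w ∧ O (b :: w)) := by
  classical
  by_cases hc : (¬ O (false :: w) ∧ ¬ O (true :: w)) ∨ n ≤ w.length
  · left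
    simp only [cstep, if_pos hc]
  · right
    have hlt : w.length < n := by
      by_contra h
      exact hc (Or.inr (not_lt.1 h))
    refine ⟨hlt, ?_⟩
    by_cases h0 : O (false :: w)
    · exact ⟨false, by simp only [cstep, if_neg hc, if_pos h0], h0⟩
    · have h1 : O (true :: w) := by
        by_contra h1
        exact hc (Or.inl ⟨h0, h1⟩)
      exact ⟨true, by simp only [cstep, if_neg hc, if_neg h0], h1⟩

/-- **The loop invariant**: every state is empty or accepted by the oracle, and never longer than
`n`. [cite: ChenEtAl2022, §5.1 (proof of Thm. 5.4)] -/
theorem crun_inv (k : ℕ) : (crun n O k = [] ∨ O (crun n O k)) ∧ (crun n O k).length ≤ n := by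
  induction k with
  | zero => exact ⟨Or.inl rfl, Nat.zero_le _⟩
  | succ k ih =>
    rw [crun_succ]
    rcases cstep_eq_self_or n O (crun n O k) with h | ⟨hlt, b, hb, hO⟩
    · rw [h]
      exact ih
    · rw [hb]
      exact ⟨Or.inr hO, by rw [List.length_cons]; omega⟩

/-- A fixed state stays fixed. [folklore] -/
theorem crun_eq_of_fix {j : ℕ} (h : cstep n O (crun n O j) = crun n O j) :
    ∀ k, j ≤ k → crun n O k = crun n O j := by
  intro k hk
  obtain ⟨d, rfl⟩ := Nat.exists_eq_add_of_le hk
  induction d with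
  | zero => rfl
  | succ d ih =>
    rw [← Nat.add_assoc, crun_succ, ih (Nat.le_add_right _ _), h]

/-- Before the first idle round the state grows by one bit per round. [folklore] -/
theorem length_crun_or (k : ℕ) :
    (crun n O k).length = k ∨ ∃ j, j < k ∧ cstep n O (crun n O j) = crun n O j := by
  induction k with
  | zero => exact Or.inl rfl
  | succ k ih =>
    rcases ih with hlen | ⟨j, hj, hfix⟩
    · rcases cstep_eq_self_or n O (crun n O k) with h | ⟨-, b, hb, -⟩
      · exact Or.inr ⟨k, Nat.lt_succ_self k, h⟩
      · left
        rw [crun_succ, hb, List.length_cons, hlen]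
    · exact Or.inr ⟨j, Nat.lt_succ_of_lt hj, hfix⟩

/-- **After `n` rounds the run is stuck or full**: `cstep` fixes `crun n O n`. [folklore] -/
theorem cstep_crun_self : cstep n O (crun n O n) = crun n O n := by
  classical
  rcases length_crun_or n O n with hlen | ⟨j, hj, hfix⟩
  · simp only [cstep, if_pos (Or.inr hlen.ge)]
  · rw [crun_eq_of_fix n O hfix n hj.le, hfix]

/-- **The clocked loop idles after round `n`**: `crun n O k = crun n O n` for `k ≥ n` (so running
it for any polynomial number `≥ n` of rounds returns the final state of Algorithm 1). [folklore] -/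
theorem crun_of_le {k : ℕ} (hk : n ≤ k) : crun n O k = crun n O n :=
  crun_eq_of_fix n O (cstep_crun_self n O) k hk

variable {n O}

/-- **Oracle congruence along the canonical path.** If `O` agrees with `O'` on the two one-bit
extensions of every short state `crun n O' k`, `k ≤ n`, of the `O'`-run, then the `O`-run and the
`O'`-run coincide for every number of rounds. (With `O'` the language of the refuted algorithm and
`O` its amplified randomized decider on fixed coins, this is "with probability `1 - 2⁻ⁿ`,
`A'(·, r)` decides the same language as `A`", localised to the queries actually made.)
[cite: ChenEtAl2022, §5.1 (proof of Thm. 5.4, case `𝒞 = BPP`)] -/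
theorem crun_congr {O' : List Bool → Prop}
    (h : ∀ k ≤ n, (crun n O' k).length < n →
      ∀ b : Bool, (O (b :: crun n O' k) ↔ O' (b :: crun n O' k))) :
    ∀ k, crun n O k = crun n O' k := by
  classical
  intro k
  induction k with
  | zero => rfl
  | succ k ih =>
    rw [crun_succ, crun_succ, ih]
    set w := crun n O' k with hw
    by_cases hfull : n ≤ w.length
    · simp only [cstep, if_pos (Or.inr hfull)]
    · have hlt : w.length < n := not_le.1 hfull
      have hagree : ∀ b : Bool, (O (b :: w) ↔ O' (b :: w)) := by
        by_cases hkn : k ≤ n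
        · exact h k hkn hlt
        · have hk : crun n O' k = crun n O' n := crun_of_le n O' (not_le.1 hkn).le
          intro b
          have := h n le_rfl (by rw [← hk]; exact hlt) b
          rwa [← hk] at this
      have h0 := hagree false
      have h1 := hagree true
      simp only [cstep, h0, h1]

/-- **The three cases of the printed correctness proof.** Let `n ≥ 1` be a bad length
(`∃ y ∈ {0,1}ⁿ, Bad y`), let `G w ⟺ ∃ v, |v ++ w| = n ∧ Bad (v ++ w)` be the truth the oracle
procedure is supposed to decide, and let `w` be the final state of the run against `O`. If the
oracle's answers on `w` (when `w ≠ ε`), `0w` and `1w` (when `|w| < n`) are the true ones, then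
`|w| = n` and `Bad w`: a short stuck `w = ε` contradicts badness of `n` ("`|x| = 0` … impossible"),
a short stuck `w ≠ ε` is accepted hence extends to a bad string through `0w` or `1w`
("`1 ≤ |x| < n` … also impossible"), and a full `w` is accepted hence bad itself ("`|x| = n` …
`L(x) ≠ A(x)`"). Consequently at least one of the four strings `w`, `Q(w)`, `Q(0w)`, `Q(1w)` of
the list is a counterexample. [cite: ChenEtAl2022, §5.1 (proof of Thm. 5.4)] -/
theorem crun_full_of_consistent {Bad : List Bool → Prop} (hn : 1 ≤ n)
    (hbad : ∃ y : List Bool, y.length = n ∧ Bad y)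
    (h₁ : crun n O n ≠ [] →
      (O (crun n O n) ↔ ∃ v : List Bool, (v ++ crun n O n).length = n ∧ Bad (v ++ crun n O n)))
    (h₂ : (crun n O n).length < n → (O (false :: crun n O n) ↔
      ∃ v : List Bool, (v ++ (false :: crun n O n)).length = n ∧ Bad (v ++ (false :: crun n O n))))
    (h₃ : (crun n O n).length < n → (O (true :: crun n O n) ↔
      ∃ v : List Bool, (v ++ (true :: crun n O n)).length = n ∧ Bad (v ++ (true :: crun n O n)))) :
    (crun n O n).length = n ∧ Bad (crun n O n) := by
  classical
  set w := crun n O n with hw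
  have hinv := crun_inv n O n
  rw [← hw] at hinv
  have hfix : cstep n O w = w := cstep_crun_self n O
  by_cases hlt : w.length < n
  · exfalso
    -- the run is stuck at `w`: both extensions are rejected
    have hstuck : ¬ O (false :: w) ∧ ¬ O (true :: w) := by
      rcases cstep_eq_self_or n O w with h | ⟨-, b, hb, -⟩
      · by_contra hno
        have hc : ¬ ((¬ O (false :: w) ∧ ¬ O (true :: w)) ∨ n ≤ w.length) := by
          rintro (h' | h')
          · exact hno h'
          · exact absurd hlt (not_lt.2 h')
        simp only [cstep, if_neg hc] at h
        split_ifs at h <;> exact List.cons_ne_self _ _ h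
      · rw [hfix] at hb
        exact absurd hb.symm (List.cons_ne_self b w)
    have hG0 := fun hg => hstuck.1 ((h₂ hlt).2 hg)
    have hG1 := fun hg => hstuck.2 ((h₃ hlt).2 hg)
    by_cases hnil : w = []
    · -- `w = ε`: a bad `y = y' ++ [b]` of length `n ≥ 1` witnesses `G (b :: ε)`
      obtain ⟨y, hy, hyB⟩ := hbad
      rcases List.eq_nil_or_concat' y with rfl | ⟨y', b, rfl⟩
      · simp at hy
        omega
      · have e : y' ++ [b] = y' ++ (b :: w) := by rw [hnil]
        cases b
        · exact hG0 ⟨y', by rw [← e]; exact hy, by rw [← e]; exact hyB⟩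
        · exact hG1 ⟨y', by rw [← e]; exact hy, by rw [← e]; exact hyB⟩
    · -- `w ≠ ε` accepted: it extends to a bad string through `0w` or `1w`
      have hOw : O w := hinv.1.resolve_left hnil
      obtain ⟨v, hv, hvB⟩ := (h₁ hnil).1 hOw
      rcases List.eq_nil_or_concat' v with rfl | ⟨v', b, rfl⟩
      · simp at hv
        omega
      · have e : v' ++ [b] ++ w = v' ++ (b :: w) := by simp
        rw [e] at hv hvB
        cases b
        · exact hG0 ⟨v', hv, hvB⟩
        · exact hG1 ⟨v', hv, hvB⟩
  · -- full: `|w| = n ≥ 1`, accepted, hence bad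
    have hlen : w.length = n := le_antisymm hinv.2 (not_lt.1 hlt)
    have hne : w ≠ [] := fun hnil => by
      rw [hnil, List.length_nil] at hlen
      omega
    have hOw : O w := hinv.1.resolve_left hne
    obtain ⟨v, hv, hvB⟩ := (h₁ hne).1 hOw
    have hv0 : v = [] := by
      have : (v ++ w).length = w.length := by rw [hv, hlen]
      simpa using this
    subst hv0
    exact ⟨hlen, by simpa using hvB⟩

end Canon

/-! ### Membership in lattice combinations of languages

`Language α` carries Mathlib's derived `CompleteAtomicBooleanAlgebra` and its own `Membership`
instance; the following definitional unfoldings (stated with VARIABLE languages, so that they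
rewrite without unfolding any machine) are used to read off membership in `⊓`, `⊔`, `ᶜ`,
preimages and set-builder languages. -/

section LMem

variable {A B : Language Bool} {f : List Bool → List Bool} {p : List Bool → Prop} {z : List Bool}

/-- Membership in an intersection of languages. [folklore] -/
theorem lmem_inf : z ∈ A ⊓ B ↔ z ∈ A ∧ z ∈ B := Iff.rfl

/-- Membership in a union of languages. [folklore] -/
theorem lmem_sup : z ∈ A ⊔ B ↔ z ∈ A ∨ z ∈ B := Iff.rfl

/-- Membership in the complement of a language. [folklore] -/
theorem lmem_compl : z ∈ Aᶜ ↔ z ∉ A := Iff.rfl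

/-- Membership in a preimage language. [folklore] -/
theorem lmem_preimage : @Membership.mem (List Bool) (Language Bool) _ (f ⁻¹' A) z ↔ f z ∈ A := Iff.rfl

/-- Membership in a set-builder language. [folklore] -/
theorem lmem_setOf : @Membership.mem (List Bool) (Language Bool) _ {y | p y} z ↔ p z := Iff.rfl

/-- Membership in the empty language. [folklore] -/
theorem lmem_bot : z ∈ (⊥ : Language Bool) ↔ False := Iff.rfl

end LMem

/-! ### The coin oracle and the stop language -/

section Machine

variable (Lamp : Language Bool) (Q : List Bool → List Bool)

/-- The coin-oracle map `⟨⟨u, r⟩, w⟩ ↦ ⟨Q⟨u, w⟩, r⟩`. [folklore] -/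
def orcMap : List Bool → List Bool :=
  fanoutFn (Q ∘ fanoutFn (fstP ∘ fstP) sndP) (sndP ∘ fstP)

/-- `orcMap Q ∈ FP` for `Q ∈ FP`. [folklore] -/
theorem orcMap_mem_FP (hQ : Q ∈ FP) : orcMap Q ∈ FP :=
  fanoutFn_mem_FP (comp_mem_FP hQ (fanoutFn_mem_FP (comp_mem_FP fstP_mem_FP fstP_mem_FP) sndP_mem_FP))
    (comp_mem_FP sndP_mem_FP fstP_mem_FP)

/-- Value of `orcMap` on a coded triple. [folklore] -/
@[simp] theorem orcMap_boolPair (u r w : List Bool) :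
    orcMap Q (boolPair (boolPair u r) w) = boolPair (Q (boolPair u w)) r := by
  simp [orcMap, Function.comp_apply]

/-- **The coin oracle** (coins carried in the instance, as in `coinOrc` of
`SearchToDecisionBPP.lean`): `⟨⟨u, r⟩, w⟩ ∈ orc ↔ ⟨Q⟨u, w⟩, r⟩ ∈ L_amp` — the verdict of the
amplified decider `A'(·, r)` of the printed proof on the query `Q⟨u, w⟩`.
[cite: ChenEtAl2022, §5.1 (proof of Thm. 5.4, case `𝒞 = BPP`)] -/
def orc : Language Bool :=
  orcMap Q ⁻¹' Lamp

/-- Membership in `orc`. [folklore] -/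
theorem mem_orc_iff (z : List Bool) : z ∈ orc Lamp Q ↔ orcMap Q z ∈ Lamp := by
  rw [orc, lmem_preimage]

/-- Membership of a coded triple in `orc`. [folklore] -/
@[simp] theorem boolPair_mem_orc (u r w : List Bool) :
    boolPair (boolPair u r) w ∈ orc Lamp Q ↔ boolPair (Q (boolPair u w)) r ∈ Lamp := by
  rw [mem_orc_iff, orcMap_boolPair]

/-- `orc ∈ P` for `L_amp ∈ P`, `Q ∈ FP`. [folklore] -/
theorem orc_mem_P (hL : Lamp ∈ Classes.P) (hQ : Q ∈ FP) : orc Lamp Q ∈ Classes.P := by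
  unfold orc
  exact preimage_mem_P hL (orcMap_mem_FP Q hQ)

/-- **The stop language of Algorithm 1**: `⟨⟨u, r⟩, w⟩ ∈ stopLang` iff both one-bit extensions
of `w` are rejected by the coin oracle, or `|u| ≤ |w|` (the state is full).
[cite: ChenEtAl2022, §5.1 (Algorithm 1)] -/
def stopLang : Language Bool :=
  ((mapSndFn (List.cons false) ⁻¹' orc Lamp Q)ᶜ ⊓ (mapSndFn (List.cons true) ⁻¹' orc Lamp Q)ᶜ) ⊔
    (fanoutFn sndP (fstP ∘ fstP) ⁻¹' LenLe X)

/-- Membership in `stopLang`. [folklore] -/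
theorem mem_stopLang_iff (z : List Bool) :
    z ∈ stopLang Lamp Q ↔
      (mapSndFn (List.cons false) z ∉ orc Lamp Q ∧ mapSndFn (List.cons true) z ∉ orc Lamp Q) ∨
        fanoutFn sndP (fstP ∘ fstP) z ∈ LenLe X := by
  rw [stopLang, lmem_sup, lmem_inf, lmem_compl, lmem_compl, lmem_preimage, lmem_preimage, lmem_preimage]

/-- Membership of a coded triple in `stopLang`. [folklore] -/
theorem boolPair_mem_stopLang (u r w : List Bool) :
    boolPair (boolPair u r) w ∈ stopLang Lamp Q ↔
      (¬ boolPair (Q (boolPair u (false :: w))) r ∈ Lamp ∧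
          ¬ boolPair (Q (boolPair u (true :: w))) r ∈ Lamp) ∨ u.length ≤ w.length := by
  rw [mem_stopLang_iff, mapSndFn_boolPair, mapSndFn_boolPair, boolPair_mem_orc, boolPair_mem_orc,
    fanoutFn_apply, Function.comp_apply, sndP_boolPair, fstP_boolPair, fstP_boolPair, boolPair_mem_LenLe,
    eval_X]

/-- `stopLang ∈ P` for `L_amp ∈ P`, `Q ∈ FP`. [folklore] -/
theorem stopLang_mem_P (hL : Lamp ∈ Classes.P) (hQ : Q ∈ FP) : stopLang Lamp Q ∈ Classes.P := by
  unfold stopLang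
  exact union_mem_P
    (inter_mem_P
      (compl_mem_P_iff.2 (preimage_mem_P (orc_mem_P Lamp Q hL hQ) (mapSndFn_mem_FP (cons_mem_FP false))))
      (compl_mem_P_iff.2 (preimage_mem_P (orc_mem_P Lamp Q hL hQ) (mapSndFn_mem_FP (cons_mem_FP true)))))
    (preimage_mem_P (LenLe_mem_P X)
      (fanoutFn_mem_FP sndP_mem_FP (comp_mem_FP fstP_mem_FP fstP_mem_FP)))

/-- **The machine follows the canonical run**: iterating the round function of `searchFnD` with
relation `stopLang` and extension oracle `orc` from `⟨⟨u, r⟩, ε⟩` yields the run of Algorithm 1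
against the coin oracle `w ↦ [⟨Q⟨u, w⟩, r⟩ ∈ L_amp]` at length `|u|`.
[cite: ChenEtAl2022, §5.1 (Algorithm 1)] -/
theorem iterate_roundFnD_stop_orc (u r : List Bool) (k : ℕ) :
    (roundFnD (stopLang Lamp Q) (orc Lamp Q))^[k] (boolPair (boolPair u r) []) =
      boolPair (boolPair u r)
        (crun u.length (fun w => boolPair (Q (boolPair u w)) r ∈ Lamp) k) := by
  classical
  induction k with
  | zero => rfl
  | succ k ih =>
    rw [Function.iterate_succ_apply', ih, crun_succ, roundFnD_boolPair]
    simp only [boolPair_mem_stopLang, boolPair_mem_orc, cstep]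
    by_cases h₁ : (¬ boolPair (Q (boolPair u (false :: crun u.length (fun w => boolPair (Q (boolPair u w)) r ∈ Lamp) k))) r ∈ Lamp ∧
        ¬ boolPair (Q (boolPair u (true :: crun u.length (fun w => boolPair (Q (boolPair u w)) r ∈ Lamp) k))) r ∈ Lamp) ∨
        u.length ≤ (crun u.length (fun w => boolPair (Q (boolPair u w)) r ∈ Lamp) k).length
    · rw [if_pos h₁, if_pos h₁]
    · rw [if_neg h₁, if_neg h₁]
      by_cases h₂ : boolPair (Q (boolPair u (false :: crun u.length (fun w => boolPair (Q (boolPair u w)) r ∈ Lamp) k))) r ∈ Lamp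
      · rw [if_pos h₂, if_pos h₂]
      · rw [if_neg h₂, if_neg h₂]

/-- **`searchFnD stopLang orc X ⟨u, r⟩` is the final state of Algorithm 1** against the coin
oracle (it runs `|⟨u, r⟩| ≥ |u|` rounds; the loop idles after round `|u|`, `crun_of_le`).
[cite: ChenEtAl2022, §5.1 (Algorithm 1)] -/
theorem searchFnD_stop_orc (u r : List Bool) :
    searchFnD (stopLang Lamp Q) (orc Lamp Q) X (boolPair u r) =
      crun u.length (fun w => boolPair (Q (boolPair u w)) r ∈ Lamp) u.length := by
  rw [searchFnD_apply, eval_X, iterate_roundFnD_stop_orc, boolUnpair_boolPair]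
  exact crun_of_le _ _ (by rw [length_boolPair]; omega)

end Machine

/-! ### Inverting the query-length polynomial (list-refuters to refuters) -/

section Inv

variable (ℓ : Polynomial ℕ)

/-- The stop language of the inversion loop: `⟨a, b⟩ ∈ invStop ℓ ↔ ℓ(|b|) = |a| ∨ |a| ≤ |b|`.
[cite: ChenEtAl2022, §5.1 (proof of the list-refuter lemma)] -/
def invStop : Language Bool :=
  ({z | (onesFn ∘ Plumb.polyFn ℓ ∘ sndP) z = (onesFn ∘ fstP) z} : Language Bool) ⊔
    (fanoutFn sndP fstP ⁻¹' LenLe X)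

/-- Membership in `invStop ℓ`. [folklore] -/
theorem mem_invStop_iff (z : List Bool) :
    z ∈ invStop ℓ ↔ (onesFn ∘ Plumb.polyFn ℓ ∘ sndP) z = (onesFn ∘ fstP) z ∨
      fanoutFn sndP fstP z ∈ LenLe X := by
  rw [invStop, lmem_sup, lmem_setOf, lmem_preimage]

/-- Membership of a pair in `invStop ℓ`. [folklore] -/
theorem boolPair_mem_invStop (a b : List Bool) :
    boolPair a b ∈ invStop ℓ ↔ ℓ.eval b.length = a.length ∨ a.length ≤ b.length := by
  rw [mem_invStop_iff]
  simp only [Function.comp_apply, sndP_boolPair, fstP_boolPair, fanoutFn_apply, boolPair_mem_LenLe,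
    eval_X]
  refine or_congr ⟨fun h => ?_, fun h => ?_⟩ Iff.rfl
  · have h' := congrArg List.length h
    rwa [length_onesFn, length_onesFn, Plumb.polyFn_apply, List.length_replicate] at h'
  · rw [onesFn, onesFn, Plumb.polyFn_apply, List.length_replicate, h]

/-- `invStop ℓ ∈ P`. [folklore] -/
theorem invStop_mem_P : invStop ℓ ∈ Classes.P := by
  unfold invStop
  exact union_mem_P
    (setOf_apply_eq_apply_mem_P
      (comp_mem_FP onesFn_mem_FP (comp_mem_FP (Plumb.polyFn_mem_FP ℓ) sndP_mem_FP))
      (comp_mem_FP onesFn_mem_FP fstP_mem_FP))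
    (preimage_mem_P (LenLe_mem_P X) (fanoutFn_mem_FP sndP_mem_FP fstP_mem_FP))

/-- The empty language is in `P` (`⊥ = T ⊓ Tᶜ` for the `P` language `T = LenLe X`). [folklore] -/
theorem bot_mem_P' : (⊥ : Language Bool) ∈ Classes.P := by
  have h := inter_mem_P (LenLe_mem_P X) (compl_mem_P_iff.2 (LenLe_mem_P X))
  rwa [inf_compl_eq_bot] at h

/-- Nothing belongs to the empty language. [folklore] -/
theorem not_mem_bot' (x : List Bool) : x ∉ (⊥ : Language Bool) := fun h => lmem_bot.1 h

/-- **The inverse of the query-length polynomial as a string function**: `invFn ℓ` runs the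
bounded search `1ʲ ↦ 1ʲ⁺¹` until `ℓ(j) = m` (or `j ≥ m`) from `⟨1ᵐ, ε⟩` — the oracle search
`searchFnD` with stop language `invStop ℓ` and empty extension oracle. On `|v| = ℓ(n)` it returns
`1ⁿ` (`invFn_spec`). This is the step "algorithm `B⁽ⁱ⁾` … is well-defined because `ℓ⁽ⁱ⁾(n)` is
strictly increasing (and hence injective)" of the printed proof of the list-refuter lemma.
[cite: ChenEtAl2022, §5.1 (proof of the list-refuter lemma)] -/
def invFn : List Bool → List Bool :=
  searchFnD (invStop ℓ) ⊥ X

/-- `invFn ℓ ∈ FP`. [cite: ChenEtAl2022, §5.1 (proof of the list-refuter lemma)] -/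
theorem invFn_mem_FP : invFn ℓ ∈ FP :=
  searchFnD_mem_FP (invStop ℓ) ⊥ X (invStop_mem_P ℓ) bot_mem_P'

variable {ℓ}

/-- The inversion loop counts up to `n` and then idles, on an input of length `ℓ(n)`. [folklore] -/
theorem iterate_roundFnD_invStop (hmono : StrictMono fun k => ℓ.eval k) (hle : ∀ k, k ≤ ℓ.eval k)
    (n : ℕ) (v : List Bool) (hv : v.length = ℓ.eval n) (k : ℕ) :
    (roundFnD (invStop ℓ) ⊥)^[k] (boolPair v []) = boolPair v (List.replicate (min k n) true) := by
  classical
  induction k with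
  | zero => simp
  | succ k ih =>
    rw [Function.iterate_succ_apply', ih, roundFnD_boolPair]
    by_cases hkn : n ≤ k
    · have hmin : min k n = n := min_eq_right hkn
      have hmin' : min (k + 1) n = n := min_eq_right (Nat.le_succ_of_le hkn)
      have hstop : boolPair v (List.replicate (min k n) true) ∈ invStop ℓ := by
        rw [boolPair_mem_invStop, List.length_replicate, hmin, hv]
        exact Or.inl rfl
      rw [if_pos hstop, hmin, hmin']
    · have hk : k < n := not_le.1 hkn
      have hmin : min k n = k := min_eq_left hk.le
      have hmin' : min (k + 1) n = k + 1 := min_eq_left hk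
      have hstop : boolPair v (List.replicate (min k n) true) ∉ invStop ℓ := by
        rw [boolPair_mem_invStop, List.length_replicate, hmin, hv]
        rintro (h | h)
        · exact absurd h (hmono hk).ne
        · exact absurd ((hle n).trans h) (not_le.2 hk)
      rw [if_neg hstop, if_neg (not_mem_bot' _), hmin, hmin', List.replicate_succ]

/-- **`invFn ℓ` inverts `ℓ` on unary inputs**: for a strictly increasing `ℓ` with `ℓ(k) ≥ k`,
`invFn ℓ v = 1ⁿ` whenever `|v| = ℓ(n)`. [cite: ChenEtAl2022, §5.1 (proof of the list-refuter lemma)] -/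
theorem invFn_spec (hmono : StrictMono fun k => ℓ.eval k) (hle : ∀ k, k ≤ ℓ.eval k) (n : ℕ)
    (v : List Bool) (hv : v.length = ℓ.eval n) : invFn ℓ v = unaryEncodeNat n := by
  rw [invFn, searchFnD_apply, eval_X, iterate_roundFnD_invStop hmono hle n v hv, boolUnpair_boolPair,
    OracleCompose.unaryEncodeNat_eq_replicate, min_eq_right (by rw [hv]; exact hle n)]

end Inv

/-! ### Refuters given by string functions -/

section Refuter

variable (F : List Bool → List Bool) (c : Polynomial ℕ)

/-- **A refuter presented by a string function**: the Gill machine on the unary input `1ᵐ` with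
coins `r` that outputs `F ⟨1ᵐ, r⟩`, with coin budget exactly `c(m)`.
[cite: ChenEtAl2022, Def. 1.1 and §5.1 (the list-refuter lemma)] -/
def strRefuter : RandAlg ℕ (List Bool) where
  run m r := F (boolPair (unaryEncodeNat m) r)
  coinLen m := c.eval m

/-- The run map of `strRefuter` (definitional). [folklore] -/
@[simp] theorem strRefuter_run (m : ℕ) (r : List Bool) :
    (strRefuter F c).run m r = F (boolPair (unaryEncodeNat m) r) := rfl

/-- The coin budget of `strRefuter` is exactly the polynomial `c`. [folklore] -/
@[simp] theorem strRefuter_coinLen (m : ℕ) : (strRefuter F c).coinLen m = c.eval m := rfl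

/-- **`strRefuter F c` is probabilistic polynomial time for `F ∈ FP`**: its run map read through
the pairing `⟨1ᵐ, r⟩` IS `F` (same machine, same polynomial), and the coin budget is a
polynomial. [cite: ChenEtAl2022, Def. 1.1] -/
theorem strRefuter_isPolyTime (hF : F ∈ FP) :
    (strRefuter F c).IsPolyTime unaryEncodeNat (id : List Bool → List Bool) := by
  refine ⟨?_, c, fun m => le_rfl⟩
  obtain ⟨P₀, M, hM⟩ := hF
  exact ⟨P₀, M, fun q => hM (boolPair (unaryEncodeNat q.1) q.2)⟩

/-- **The success probability of `strRefuter` is a counting probability** over the coin strings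
of length `c(m)`. [folklore] -/
theorem strRefuter_pr (m : ℕ) (E : Set (List Bool)) :
    (strRefuter F c).pr unaryEncodeNat m E =
      uniformProb (c.eval m) {r : List Bool | F (boolPair (unaryEncodeNat m) r) ∈ E} := by
  rw [RandAlg.pr_eq_uniformProb]
  simp only [strRefuter_coinLen, strRefuter_run]
  rw [show (unaryEncodeNat m).length = m from unary_decode_encode_nat m]

end Refuter

end Literature.Computability.MetaComplexity

end
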